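import Summits.FinalStateConjecture.FinalStateConjecture.Theses.ClusterCompleteness
import Literature.Geometry.Lorentzian.CoordCurvature

/-! # Birth skeleton (BC3) for `ClusterCompleteness.GenericTameNonExtremalEra` (child 1 of the split of `OmegaLimitMultiKerr`) — see Lines/birth.md -/

set_option linter.dupNamespace false

noncomputable section

open scoped Manifold ContDiff Topology ENNReal
open Set Filter Function TopologicalSpace

namespace Summit.FinalStateConjecture.FinalStateConjecture.Cruxes.GenericTameNonExtremalEra.Birth

open Literature.Geometry.Lorentzian

/-! ### The piece (child 1 of the split of `ClusterCompleteness.OmegaLimitMultiKerr`), verbatim -/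

/-- `Sig.GenericTameNonExtremalEra` — VERBATIM the statement of the route item
`ClusterCompleteness.GenericTameNonExtremalEra` (child 1 of the BC2 redirect of `OmegaLimitMultiKerr`). -/
def Sig.GenericTameNonExtremalEra : Prop :=
  open Literature.Geometry.Lorentzian in open scoped ContDiff in ∀ (k : ℕ) (X : Type) [TopologicalSpace X] [ChartedSpace E3 X] [IsManifold (𝓡 3) ∞ X] [T2Space X] [SecondCountableTopology X] [ConnectedSpace X], InitialDataSet.IsTameChristodoulouGeneric (admissibleVacuumData X) (fun D ↦ (∃ 𝒟 : VacuumCauchyDevelopment D, 𝒟.IsMaximal) ∧ ∀ 𝒟 : VacuumCauchyDevelopment D, 𝒟.IsMaximal → ¬ (Summit.FinalStateConjecture.HasCompleteNullInfinity 𝒟.toCauchyDevelopment ∧ ∃ (O : Set 𝒟.carrier) (d : FinalStateDecomposition 𝒟.toSpacetime O 2), (∀ i, Kerr.IsSubextremal (d.mass i) (d.spin i)) ∧ O = Summit.FinalStateConjecture.exteriorOf 𝒟.toCauchyDevelopment d.charted ∧ Summit.FinalStateConjecture.RaysStayInClosure 𝒟.toCauchyDevelopment O ∧ Summit.FinalStateConjecture.HasExhaustiveCharts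 d ∧ Summit.FinalStateConjecture.IsFutureOriented d) → (∃ (O : Set 𝒟.carrier) (N : ℕ) (M a : Fin N → ℝ) (mo : Fin N → lorentzGroup × E4) (τ₀ : ℝ) (Ψ : ∀ i, boostedKerrExterior (mo i).1 (mo i).2 (M i) (a i) → 𝒟.carrier) (ρ R : Fin N → ℝ → ℝ) (U₀ : Opens E4) (Ψ₀ : U₀ → 𝒟.carrier), (∀ i, 0 < M i ∧ |a i| ≤ M i) ∧ (∀ i, 𝒟.toSpacetime.IsLateChart (boostedKerrBackground (mo i).1 (mo i).2 (M i) (a i)) O τ₀ (Ψ i)) ∧ 𝒟.toSpacetime.IsLateChart (Minkowski.backgroundOn U₀) O τ₀ Ψ₀ ∧ (∀ i, Tendsto (fun t ↦ ρ i t / t) atTop (𝓝 0)) ∧ (∀ i, Tendsto (R i) atTop atTop ∧ ∀ τ, max (Kerr.rPlus (M i) (a i)) 0 + 1 ≤ R i τ) ∧ {x : E4 | τ₀ < x 0 ∧ ∀ i, ρ i (x 0) < Kerr.radius (a i) (poincareInv (mo i).1 (mo i).2 x)} ⊆ (U₀ : Set E4) ∧ (∀ R' : ℝ, ∃ τ₁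 : ℝ, Pairwise (Function.onFun Disjoint fun i ↦ Ψ i '' (boostedKerrBackground (mo i).1 (mo i).2 (M i) (a i)).truncLateRegion τ₁ R')) ∧ O = Summit.FinalStateConjecture.exteriorOf 𝒟.toCauchyDevelopment ((⋃ i, Ψ i '' (boostedKerrBackground (mo i).1 (mo i).2 (M i) (a i)).lateRegion τ₀) ∪ Ψ₀ '' (Minkowski.backgroundOn U₀).lateRegion τ₀) ∧ Summit.FinalStateConjecture.RaysStayInClosure 𝒟.toCauchyDevelopment O ∧ (∀ τ₁ : ℝ, τ₀ < τ₁ → O \ (Ψ₀ '' (Minkowski.backgroundOn U₀).lateRegion τ₁ ∪ ⋃ i, Ψ i '' {x | τ₁ < (boostedKerrBackground (mo i).1 (mo i).2 (M i) (a i)).time x.1 ∧ (boostedKerrBackground (mo i).1 (mo i).2 (M i) (a i)).radius x.1 ≤ R i ((boostedKerrBackground (mo i).1 (mo i).2 (M i) (a i)).time x.1)}) ⊆ 𝒟.metric.causalPast 𝒟.timeOrientation (Ψ₀ '' (Minkowski.backgroundOn U₀).timeSlab τ₁ ∪ ⋃ i, Ψ i '' (boostedKerrBackground (mo i).1 (mo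 i).2 (M i) (a i)).truncTimeSlab (R i τ₁) τ₁)) ∧ ((∀ i, Summit.FinalStateConjecture.IsOrthochronous (mo i).1) ∧ ∀ τ : ℝ, τ₀ < τ → ∀ x ∈ (Minkowski.backgroundOn U₀).timeSlab τ, 𝒟.toSpacetime.timeOrientation.IsFutureDirected (mfderiv 𝓘(ℝ, E4) (𝓡 4) Ψ₀ x (E4.basisVector 0))) ∧ (∀ τ : ℝ, τ₀ < τ → 𝒟.toSpacetime.deviationCk (Minkowski.backgroundOn U₀) Ψ₀ 0 τ ≤ ENNReal.ofReal (1 / 8) ∧ ∀ i, 𝒟.toSpacetime.truncDeviationCk (boostedKerrBackground (mo i).1 (mo i).2 (M i) (a i)) (Ψ i) 0 (R i τ) τ ≤ ENNReal.ofReal (1 / 8)) ∧ (∃ B : NNReal, ∀ τ : ℝ, τ₀ < τ → 𝒟.toSpacetime.deviationCk (Minkowski.backgroundOn U₀) Ψ₀ (k + 4) τ ≤ (B : ENNReal)) ∧ (∀ R' : ℝ, ∃ B : NNReal, ∀ τ : ℝ, τ₀ < τ → ∀ i, 𝒟.toSpacetime.truncDeviationCk (boostedKerrBackground (mo i).1 (mo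 i).2 (M i) (a i)) (Ψ i) (k + 4) R' τ ≤ (B : ENNReal)) ∧ (∀ ε : ℝ, 0 < ε → ∃ Rf : ℝ, ∀ τ : ℝ, τ₀ < τ → supCkENorm (Subtype.val '' {x | x ∈ (Minkowski.backgroundOn U₀).timeSlab τ ∧ Rf ≤ ‖E4.spatial (x : E4)‖}) (k + 4) (𝒟.toSpacetime.deviationExtend (Minkowski.backgroundOn U₀) Ψ₀) ≤ ENNReal.ofReal ε)) ∧ ∀ (O : Set 𝒟.carrier) (N : ℕ) (M a : Fin N → ℝ) (mo : Fin N → lorentzGroup × E4) (τ₀ : ℝ) (Ψ : ∀ i, boostedKerrExterior (mo i).1 (mo i).2 (M i) (a i) → 𝒟.carrier) (ρ R : Fin N → ℝ → ℝ) (U₀ : Opens E4) (Ψ₀ : U₀ → 𝒟.carrier), (∀ i, 0 < M i ∧ |a i| ≤ M i) ∧ (∀ i, 𝒟.toSpacetime.IsLateChart (boostedKerrBackground (mo i).1 (mo i).2 (M i) (a i)) O τ₀ (Ψ i)) ∧ 𝒟.toSpacetime.IsLateChart (Minkowski.backgroundOn U₀) O τ₀ Ψ₀ ∧ (∀ i,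 Tendsto (fun t ↦ ρ i t / t) atTop (𝓝 0)) ∧ (∀ i, Tendsto (R i) atTop atTop ∧ ∀ τ, max (Kerr.rPlus (M i) (a i)) 0 + 1 ≤ R i τ) ∧ {x : E4 | τ₀ < x 0 ∧ ∀ i, ρ i (x 0) < Kerr.radius (a i) (poincareInv (mo i).1 (mo i).2 x)} ⊆ (U₀ : Set E4) ∧ (∀ R' : ℝ, ∃ τ₁ : ℝ, Pairwise (Function.onFun Disjoint fun i ↦ Ψ i '' (boostedKerrBackground (mo i).1 (mo i).2 (M i) (a i)).truncLateRegion τ₁ R')) ∧ O = Summit.FinalStateConjecture.exteriorOf 𝒟.toCauchyDevelopment ((⋃ i, Ψ i '' (boostedKerrBackground (mo i).1 (mo i).2 (M i) (a i)).lateRegion τ₀) ∪ Ψ₀ '' (Minkowski.backgroundOn U₀).lateRegion τ₀) ∧ Summit.FinalStateConjecture.RaysStayInClosure 𝒟.toCauchyDevelopment O ∧ (∀ τ₁ : ℝ, τ₀ < τ₁ → O \ (Ψ₀ '' (Minkowski.backgroundOn U₀).lateRegion τ₁ ∪ ⋃ i, Ψ i '' {x | τ₁ < (boostedKerrBackground (mo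 i).1 (mo i).2 (M i) (a i)).time x.1 ∧ (boostedKerrBackground (mo i).1 (mo i).2 (M i) (a i)).radius x.1 ≤ R i ((boostedKerrBackground (mo i).1 (mo i).2 (M i) (a i)).time x.1)}) ⊆ 𝒟.metric.causalPast 𝒟.timeOrientation (Ψ₀ '' (Minkowski.backgroundOn U₀).timeSlab τ₁ ∪ ⋃ i, Ψ i '' (boostedKerrBackground (mo i).1 (mo i).2 (M i) (a i)).truncTimeSlab (R i τ₁) τ₁)) ∧ ((∀ i, Summit.FinalStateConjecture.IsOrthochronous (mo i).1) ∧ ∀ τ : ℝ, τ₀ < τ → ∀ x ∈ (Minkowski.backgroundOn U₀).timeSlab τ, 𝒟.toSpacetime.timeOrientation.IsFutureDirected (mfderiv 𝓘(ℝ, E4) (𝓡 4) Ψ₀ x (E4.basisVector 0))) ∧ (∀ τ : ℝ, τ₀ < τ → 𝒟.toSpacetime.deviationCk (Minkowski.backgroundOn U₀) Ψ₀ 0 τ ≤ ENNReal.ofReal (1 / 4) ∧ ∀ i, 𝒟.toSpacetime.truncDeviationCk (boostedKerrBackground (mo i).1 (mo i).2 (M i) (a i)) (Ψ i) 0 (R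 i τ) τ ≤ ENNReal.ofReal (1 / 4)) ∧ (∀ R' : ℝ, ∀ ε : ℝ, 0 < ε → ∃ᶠ τ in atTop, 𝒟.toSpacetime.deviationCk (Minkowski.backgroundOn U₀) Ψ₀ (k + 2) τ ≤ ENNReal.ofReal ε ∧ ∀ i, 𝒟.toSpacetime.truncDeviationCk (boostedKerrBackground (mo i).1 (mo i).2 (M i) (a i)) (Ψ i) (k + 2) R' τ ≤ ENNReal.ofReal ε ∧ ∀ x ∈ (boostedKerrBackground (mo i).1 (mo i).2 (M i) (a i)).truncTimeSlab R' τ, 𝒟.toSpacetime.timeOrientation.IsFutureDirected (mfderiv 𝓘(ℝ, E4) (𝓡 4) (Ψ i) x (((mo i).1 : E4 ≃L[ℝ] E4) (Kerr.timeVector (M i) (a i) (poincareInv (mo i).1 (mo i).2 (x : E4)))))) → ∀ i, Kerr.IsSubextremal (M i) (a i)) 1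

/-! ### Stub signatures -/

/-- Signature of `stub_genericTameEraRedShift` (see the stub's docstring). -/
def Sig.stub_genericTameEraRedShift : Prop :=
  ∀ (k : ℕ) (X : Type) [TopologicalSpace X] [ChartedSpace E3 X] [IsManifold (𝓡 3) ∞ X] [T2Space X] [SecondCountableTopology X] [ConnectedSpace X], InitialDataSet.IsTameChristodoulouGeneric (admissibleVacuumData X) (fun D ↦ (∃ 𝒟 : VacuumCauchyDevelopment D, 𝒟.IsMaximal) ∧ ∀ 𝒟 : VacuumCauchyDevelopment D, 𝒟.IsMaximal → ¬ (Summit.FinalStateConjecture.HasCompleteNullInfinity 𝒟.toCauchyDevelopment ∧ ∃ (O : Set 𝒟.carrier) (d : FinalStateDecomposition 𝒟.toSpacetime O 2), (∀ i, Kerr.IsSubextremal (d.mass i) (d.spin i)) ∧ O = Summit.FinalStateConjecture.exteriorOf 𝒟.toCauchyDevelopment d.charted ∧ Summit.FinalStateConjecture.RaysStayInClosure 𝒟.toCauchyDevelopment O ∧ Summit.FinalStateConjecture.HasExhaustiveCharts d ∧ Summit.FinalStateConjecture.IsFutureOriented d) → ∃ (O : Set 𝒟.carrier) (N : ℕ)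 (M a : Fin N → ℝ) (mo : Fin N → lorentzGroup × E4) (τ₀ : ℝ) (Ψ : ∀ i, boostedKerrExterior (mo i).1 (mo i).2 (M i) (a i) → 𝒟.carrier) (ρ R : Fin N → ℝ → ℝ) (U₀ : Opens E4) (Ψ₀ : U₀ → 𝒟.carrier), ((∀ i, 0 < M i ∧ |a i| ≤ M i) ∧ (∀ i, 𝒟.toSpacetime.IsLateChart (boostedKerrBackground (mo i).1 (mo i).2 (M i) (a i)) O τ₀ (Ψ i)) ∧ 𝒟.toSpacetime.IsLateChart (Minkowski.backgroundOn U₀) O τ₀ Ψ₀ ∧ (∀ i, Tendsto (fun t ↦ ρ i t / t) atTop (𝓝 0)) ∧ (∀ i, Tendsto (R i) atTop atTop ∧ ∀ τ, max (Kerr.rPlus (M i) (a i)) 0 + 1 ≤ R i τ) ∧ {x : E4 | τ₀ < x 0 ∧ ∀ i, ρ i (x 0) < Kerr.radius (a i) (poincareInv (mo i).1 (mo i).2 x)} ⊆ (U₀ : Set E4) ∧ (∀ R' : ℝ, ∃ τ₁ : ℝ, Pairwise (Function.onFun Disjoint fun i ↦ Ψ i '' (boostedKerrBackground (mo i).1 (mo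 i).2 (M i) (a i)).truncLateRegion τ₁ R')) ∧ O = Summit.FinalStateConjecture.exteriorOf 𝒟.toCauchyDevelopment ((⋃ i, Ψ i '' (boostedKerrBackground (mo i).1 (mo i).2 (M i) (a i)).lateRegion τ₀) ∪ Ψ₀ '' (Minkowski.backgroundOn U₀).lateRegion τ₀) ∧ Summit.FinalStateConjecture.RaysStayInClosure 𝒟.toCauchyDevelopment O ∧ (∀ τ₁ : ℝ, τ₀ < τ₁ → O \ (Ψ₀ '' (Minkowski.backgroundOn U₀).lateRegion τ₁ ∪ ⋃ i, Ψ i '' {x | τ₁ < (boostedKerrBackground (mo i).1 (mo i).2 (M i) (a i)).time x.1 ∧ (boostedKerrBackground (mo i).1 (mo i).2 (M i) (a i)).radius x.1 ≤ R i ((boostedKerrBackground (mo i).1 (mo i).2 (M i) (a i)).time x.1)}) ⊆ 𝒟.metric.causalPast 𝒟.timeOrientation (Ψ₀ '' (Minkowski.backgroundOn U₀).timeSlab τ₁ ∪ ⋃ i, Ψ i '' (boostedKerrBackground (mo i).1 (mo i).2 (M i) (a i)).truncTimeSlab (R i τ₁) τ₁)) ∧ ((∀ i, Summit.FinalStateConjecture.IsOrthochronous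 (mo i).1) ∧ ∀ τ : ℝ, τ₀ < τ → ∀ x ∈ (Minkowski.backgroundOn U₀).timeSlab τ, 𝒟.toSpacetime.timeOrientation.IsFutureDirected (mfderiv 𝓘(ℝ, E4) (𝓡 4) Ψ₀ x (E4.basisVector 0))) ∧ (∀ τ : ℝ, τ₀ < τ → 𝒟.toSpacetime.deviationCk (Minkowski.backgroundOn U₀) Ψ₀ 0 τ ≤ ENNReal.ofReal (1 / 8) ∧ ∀ i, 𝒟.toSpacetime.truncDeviationCk (boostedKerrBackground (mo i).1 (mo i).2 (M i) (a i)) (Ψ i) 0 (R i τ) τ ≤ ENNReal.ofReal (1 / 8)) ∧ (∃ B : NNReal, ∀ τ : ℝ, τ₀ < τ → 𝒟.toSpacetime.deviationCk (Minkowski.backgroundOn U₀) Ψ₀ (k + 4) τ ≤ (B : ENNReal)) ∧ (∀ R' : ℝ, ∃ B : NNReal, ∀ τ : ℝ, τ₀ < τ → ∀ i, 𝒟.toSpacetime.truncDeviationCk (boostedKerrBackground (mo i).1 (mo i).2 (M i) (a i)) (Ψ i) (k + 4) R' τ ≤ (B : ENNReal)) ∧ (∀ ε : ℝ, 0 < ε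 → ∃ Rf : ℝ, ∀ τ : ℝ, τ₀ < τ → supCkENorm (Subtype.val '' {x | x ∈ (Minkowski.backgroundOn U₀).timeSlab τ ∧ Rf ≤ ‖E4.spatial (x : E4)‖}) (k + 4) (𝒟.toSpacetime.deviationExtend (Minkowski.backgroundOn U₀) Ψ₀) ≤ ENNReal.ofReal ε)) ∧ ∀ i, (∃ κ₀ δ : ℝ, 0 < κ₀ ∧ 0 < δ ∧ ∀ τ : ℝ, τ₀ < τ → ∀ x ∈ (boostedKerrBackground (mo i).1 (mo i).2 (M i) (a i)).truncTimeSlab (Kerr.rPlus (M i) (a i) + δ) τ, κ₀ * ((boostedKerrBackground (mo i).1 (mo i).2 (M i) (a i)).radius x.1 - Kerr.rPlus (M i) (a i)) ≤ ((fderiv ℝ (fun y ↦ Kerr.radius (a i) (poincareInv (mo i).1 (mo i).2 y)) (x : E4)) (MetricCoord.sharpAt (fun y ↦ (𝒟.toSpacetime.deviationExtend (boostedKerrBackground (mo i).1 (mo i).2 (M i) (a i)) (Ψ i)) y + boostedKerrBilin (mo i).1 (mo i).2 (M i) (a i) y) (x : E4) (fderiv ℝ (fun y ↦ Kerr.radius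 (a i) (poincareInv (mo i).1 (mo i).2 y)) (x : E4)))))) 1

/-- Signature of `stub_redShiftExcludesExtremalRecurrence` (see the stub's docstring). -/
def Sig.stub_redShiftExcludesExtremalRecurrence : Prop :=
  ∀ (k : ℕ) (X : Type) [TopologicalSpace X] [ChartedSpace E3 X] [IsManifold (𝓡 3) ∞ X] [T2Space X] [SecondCountableTopology X] [ConnectedSpace X], ∀ D ∈ admissibleVacuumData X, ∀ 𝒟 : VacuumCauchyDevelopment D, 𝒟.IsMaximal → (∃ (O : Set 𝒟.carrier) (N : ℕ) (M a : Fin N → ℝ) (mo : Fin N → lorentzGroup × E4) (τ₀ : ℝ) (Ψ : ∀ i, boostedKerrExterior (mo i).1 (mo i).2 (M i) (a i) → 𝒟.carrier) (ρ R : Fin N → ℝ → ℝ) (U₀ : Opens E4) (Ψ₀ : U₀ → 𝒟.carrier), ((∀ i, 0 < M i ∧ |a i| ≤ M i) ∧ (∀ i, 𝒟.toSpacetime.IsLateChart (boostedKerrBackground (mo i).1 (mo i).2 (M i) (a i)) O τ₀ (Ψ i)) ∧ 𝒟.toSpacetime.IsLateChart (Minkowski.backgroundOn U₀) O τ₀ Ψ₀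 ∧ (∀ i, Tendsto (fun t ↦ ρ i t / t) atTop (𝓝 0)) ∧ (∀ i, Tendsto (R i) atTop atTop ∧ ∀ τ, max (Kerr.rPlus (M i) (a i)) 0 + 1 ≤ R i τ) ∧ {x : E4 | τ₀ < x 0 ∧ ∀ i, ρ i (x 0) < Kerr.radius (a i) (poincareInv (mo i).1 (mo i).2 x)} ⊆ (U₀ : Set E4) ∧ (∀ R' : ℝ, ∃ τ₁ : ℝ, Pairwise (Function.onFun Disjoint fun i ↦ Ψ i '' (boostedKerrBackground (mo i).1 (mo i).2 (M i) (a i)).truncLateRegion τ₁ R')) ∧ O = Summit.FinalStateConjecture.exteriorOf 𝒟.toCauchyDevelopment ((⋃ i, Ψ i '' (boostedKerrBackground (mo i).1 (mo i).2 (M i) (a i)).lateRegion τ₀) ∪ Ψ₀ '' (Minkowski.backgroundOn U₀).lateRegion τ₀) ∧ Summit.FinalStateConjecture.RaysStayInClosure 𝒟.toCauchyDevelopment O ∧ (∀ τ₁ : ℝ, τ₀ < τ₁ → O \ (Ψ₀ '' (Minkowski.backgroundOn U₀).lateRegion τ₁ ∪ ⋃ i, Ψ i '' {x | τ₁ < (boostedKerrBackground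 (mo i).1 (mo i).2 (M i) (a i)).time x.1 ∧ (boostedKerrBackground (mo i).1 (mo i).2 (M i) (a i)).radius x.1 ≤ R i ((boostedKerrBackground (mo i).1 (mo i).2 (M i) (a i)).time x.1)}) ⊆ 𝒟.metric.causalPast 𝒟.timeOrientation (Ψ₀ '' (Minkowski.backgroundOn U₀).timeSlab τ₁ ∪ ⋃ i, Ψ i '' (boostedKerrBackground (mo i).1 (mo i).2 (M i) (a i)).truncTimeSlab (R i τ₁) τ₁)) ∧ ((∀ i, Summit.FinalStateConjecture.IsOrthochronous (mo i).1) ∧ ∀ τ : ℝ, τ₀ < τ → ∀ x ∈ (Minkowski.backgroundOn U₀).timeSlab τ, 𝒟.toSpacetime.timeOrientation.IsFutureDirected (mfderiv 𝓘(ℝ, E4) (𝓡 4) Ψ₀ x (E4.basisVector 0))) ∧ (∀ τ : ℝ, τ₀ < τ → 𝒟.toSpacetime.deviationCk (Minkowski.backgroundOn U₀) Ψ₀ 0 τ ≤ ENNReal.ofReal (1 / 8) ∧ ∀ i, 𝒟.toSpacetime.truncDeviationCk (boostedKerrBackground (mo i).1 (mo i).2 (M i) (a i)) (Ψ i) 0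 (R i τ) τ ≤ ENNReal.ofReal (1 / 8)) ∧ (∃ B : NNReal, ∀ τ : ℝ, τ₀ < τ → 𝒟.toSpacetime.deviationCk (Minkowski.backgroundOn U₀) Ψ₀ (k + 4) τ ≤ (B : ENNReal)) ∧ (∀ R' : ℝ, ∃ B : NNReal, ∀ τ : ℝ, τ₀ < τ → ∀ i, 𝒟.toSpacetime.truncDeviationCk (boostedKerrBackground (mo i).1 (mo i).2 (M i) (a i)) (Ψ i) (k + 4) R' τ ≤ (B : ENNReal)) ∧ (∀ ε : ℝ, 0 < ε → ∃ Rf : ℝ, ∀ τ : ℝ, τ₀ < τ → supCkENorm (Subtype.val '' {x | x ∈ (Minkowski.backgroundOn U₀).timeSlab τ ∧ Rf ≤ ‖E4.spatial (x : E4)‖}) (k + 4) (𝒟.toSpacetime.deviationExtend (Minkowski.backgroundOn U₀) Ψ₀) ≤ ENNReal.ofReal ε)) ∧ ∀ i, (∃ κ₀ δ : ℝ, 0 < κ₀ ∧ 0 < δ ∧ ∀ τ : ℝ, τ₀ < τ → ∀ x ∈ (boostedKerrBackground (mo i).1 (mo i).2 (M i) (a i)).truncTimeSlab (Kerr.rPlus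 (M i) (a i) + δ) τ, κ₀ * ((boostedKerrBackground (mo i).1 (mo i).2 (M i) (a i)).radius x.1 - Kerr.rPlus (M i) (a i)) ≤ ((fderiv ℝ (fun y ↦ Kerr.radius (a i) (poincareInv (mo i).1 (mo i).2 y)) (x : E4)) (MetricCoord.sharpAt (fun y ↦ (𝒟.toSpacetime.deviationExtend (boostedKerrBackground (mo i).1 (mo i).2 (M i) (a i)) (Ψ i)) y + boostedKerrBilin (mo i).1 (mo i).2 (M i) (a i) y) (x : E4) (fderiv ℝ (fun y ↦ Kerr.radius (a i) (poincareInv (mo i).1 (mo i).2 y)) (x : E4)))))) → ∀ (O : Set 𝒟.carrier) (N : ℕ) (M a : Fin N → ℝ) (mo : Fin N → lorentzGroup × E4) (τ₀ : ℝ) (Ψ : ∀ i, boostedKerrExterior (mo i).1 (mo i).2 (M i) (a i) → 𝒟.carrier) (ρ R : Fin N → ℝ → ℝ) (U₀ : Opens E4) (Ψ₀ : U₀ → 𝒟.carrier), (∀ i, 0 < M i ∧ |a i| ≤ M i) ∧ (∀ i, 𝒟.toSpacetime.IsLateChart (boostedKerrBackground (mo i).1 (mo i).2 (M i) (a i)) O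 τ₀ (Ψ i)) ∧ 𝒟.toSpacetime.IsLateChart (Minkowski.backgroundOn U₀) O τ₀ Ψ₀ ∧ (∀ i, Tendsto (fun t ↦ ρ i t / t) atTop (𝓝 0)) ∧ (∀ i, Tendsto (R i) atTop atTop ∧ ∀ τ, max (Kerr.rPlus (M i) (a i)) 0 + 1 ≤ R i τ) ∧ {x : E4 | τ₀ < x 0 ∧ ∀ i, ρ i (x 0) < Kerr.radius (a i) (poincareInv (mo i).1 (mo i).2 x)} ⊆ (U₀ : Set E4) ∧ (∀ R' : ℝ, ∃ τ₁ : ℝ, Pairwise (Function.onFun Disjoint fun i ↦ Ψ i '' (boostedKerrBackground (mo i).1 (mo i).2 (M i) (a i)).truncLateRegion τ₁ R')) ∧ O = Summit.FinalStateConjecture.exteriorOf 𝒟.toCauchyDevelopment ((⋃ i, Ψ i '' (boostedKerrBackground (mo i).1 (mo i).2 (M i) (a i)).lateRegion τ₀) ∪ Ψ₀ '' (Minkowski.backgroundOn U₀).lateRegion τ₀) ∧ Summit.FinalStateConjecture.RaysStayInClosure 𝒟.toCauchyDevelopment O ∧ (∀ τ₁ : ℝ, τ₀ < τ₁ → O \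 (Ψ₀ '' (Minkowski.backgroundOn U₀).lateRegion τ₁ ∪ ⋃ i, Ψ i '' {x | τ₁ < (boostedKerrBackground (mo i).1 (mo i).2 (M i) (a i)).time x.1 ∧ (boostedKerrBackground (mo i).1 (mo i).2 (M i) (a i)).radius x.1 ≤ R i ((boostedKerrBackground (mo i).1 (mo i).2 (M i) (a i)).time x.1)}) ⊆ 𝒟.metric.causalPast 𝒟.timeOrientation (Ψ₀ '' (Minkowski.backgroundOn U₀).timeSlab τ₁ ∪ ⋃ i, Ψ i '' (boostedKerrBackground (mo i).1 (mo i).2 (M i) (a i)).truncTimeSlab (R i τ₁) τ₁)) ∧ ((∀ i, Summit.FinalStateConjecture.IsOrthochronous (mo i).1) ∧ ∀ τ : ℝ, τ₀ < τ → ∀ x ∈ (Minkowski.backgroundOn U₀).timeSlab τ, 𝒟.toSpacetime.timeOrientation.IsFutureDirected (mfderiv 𝓘(ℝ, E4) (𝓡 4) Ψ₀ x (E4.basisVector 0))) ∧ (∀ τ : ℝ, τ₀ < τ → 𝒟.toSpacetime.deviationCk (Minkowski.backgroundOn U₀) Ψ₀ 0 τ ≤ ENNReal.ofReal (1 / 4)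 ∧ ∀ i, 𝒟.toSpacetime.truncDeviationCk (boostedKerrBackground (mo i).1 (mo i).2 (M i) (a i)) (Ψ i) 0 (R i τ) τ ≤ ENNReal.ofReal (1 / 4)) ∧ (∀ R' : ℝ, ∀ ε : ℝ, 0 < ε → ∃ᶠ τ in atTop, 𝒟.toSpacetime.deviationCk (Minkowski.backgroundOn U₀) Ψ₀ (k + 2) τ ≤ ENNReal.ofReal ε ∧ ∀ i, 𝒟.toSpacetime.truncDeviationCk (boostedKerrBackground (mo i).1 (mo i).2 (M i) (a i)) (Ψ i) (k + 2) R' τ ≤ ENNReal.ofReal ε ∧ ∀ x ∈ (boostedKerrBackground (mo i).1 (mo i).2 (M i) (a i)).truncTimeSlab R' τ, 𝒟.toSpacetime.timeOrientation.IsFutureDirected (mfderiv 𝓘(ℝ, E4) (𝓡 4) (Ψ i) x (((mo i).1 : E4 ≃L[ℝ] E4) (Kerr.timeVector (M i) (a i) (poincareInv (mo i).1 (mo i).2 (x : E4)))))) → ∀ i, Kerr.IsSubextremal (M i) (a i)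

/-- Tame Christodoulou genericity is monotone under pointwise implication on the class (the same
tame immersed family through an exceptional datum works). Local copy (as in `Lines/birth.lean`). [folklore] -/
theorem isTameChristodoulouGeneric_mono {X : Type} [TopologicalSpace X] [ChartedSpace E3 X]
    [IsManifold (𝓡 3) ∞ X] {𝓓 : Set (InitialDataSet (𝓡 3) X)}
    {P Q : InitialDataSet (𝓡 3) X → Prop} {m : ℕ}
    (h : InitialDataSet.IsTameChristodoulouGeneric 𝓓 P m) (hPQ : ∀ d ∈ 𝓓, P d → Q d) :
    InitialDataSet.IsTameChristodoulouGeneric 𝓓 Q m := by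
  intro d hd
  obtain ⟨e, F, hF, himm, h0, hinj, hadm, hexc⟩ := h d ⟨hd.1, fun hP ↦ hd.2 (hPQ d hd.1 hP)⟩
  exact ⟨e, F, hF, himm, h0, hinj, hadm,
    fun c hc hmem ↦ hexc c hc ⟨hmem.1, fun hP ↦ hmem.2 (hPQ _ hmem.1 hP)⟩⟩

/-! ### The registered stubs (the ONLY sorries of this file) -/

/-- **STUB 1 `stub_genericTameEraRedShift` (GENERIC; the summit pre-phase without identification —
weak cosmic censorship to the late phase + a-priori bounds + orbital anchor + NON-DEGENERATE HORIZONS;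
FSC-implied through the settle disjunct, hence never too strong).** Tame-Christodoulou-generically in the
admissible class: an MGHD exists and every MGHD that does not settle (T2) carries a TAME ERA (closed-label
chart system C2–C11 of the crux's interface, `C⁰` anchor `1/8`, all-time `C^{k+4}` bounds, far-field
quarantine) each of whose hole charts has UNIFORMLY NON-DEGENERATE RED-SHIFT at its inner boundary:
`hᵢ⁻¹(drᵢ, drᵢ) ≥ κ₀ (rᵢ − r₊)` on a horizon collar at all late times (surface gravity bounded below —
the gauge-free form of "no extremal limit", the generic content behind `Literature.Barriers.
FinalStateConjecture.AretakisInstability`). Why it might fail short of the summit: generic developments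
with no precompact late-time translates in any era gauge, eternal bound `N`-body motion, generic
extremal LIMITS (κ → 0), persistent incoming far-field radiation (quarantine). Sources: Dafermos–Luk
arXiv:1710.01722 §1.2.1; Christodoulou CQG 16 (1999) A23; Aretakis arXiv:1206.6598. [cite: DafermosLuk2017] -/
theorem stub_genericTameEraRedShift : Sig.stub_genericTameEraRedShift := by
  sorry

/-- **STUB 2 `stub_redShiftExcludesExtremalRecurrence` (POINTWISE red-shift rigidity; L).** A maximal
development of admissible data carrying a tame era with uniformly non-degenerate red-shift at every hole's
inner boundary cannot recur, at any order `≥ 2` and in ANY anchored exhaustive closed-label chart system,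
to a configuration with an extremal hole `|aⱼ'| = Mⱼ'`: both systems cover the horizon collars (exhaustion
C10 + separation C7), the transition maps are uniformly bi-Lipschitz with bounded second derivatives
(both chart metrics non-degenerate up to the boundary, Kerr–Schild regular across `r = r₊`), both inner
boundaries are the event horizon, and `C²`-closeness to extremal Kerr–Schild forces
`h'⁻¹(dr', dr') ≤ C (r' − M')² + o(1)`, contradicting `hᵢ⁻¹(drᵢ, drᵢ) ≥ κ₀ (rᵢ − r₊)`. [folklore] -/
theorem stub_redShiftExcludesExtremalRecurrence : Sig.stub_redShiftExcludesExtremalRecurrence := by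
  sorry

/-! ### Composition -/

/-- **Child 1 from its stubs.** Monotonicity of tame genericity in the property: the red-shift era of the
generic stub is in particular a tame era, and the pointwise stub turns its red-shift clause into the
exclusion of extremal recurrent labels. -/
theorem GenericTameNonExtremalEra_of (hα : Sig.stub_genericTameEraRedShift)
    (hβ : Sig.stub_redShiftExcludesExtremalRecurrence) : Sig.GenericTameNonExtremalEra := by
  intro k X _ _ _ _ _ _
  refine isTameChristodoulouGeneric_mono (hα k X) ?_
  rintro D hD ⟨hM, hP⟩
  refine ⟨hM, fun 𝒟 hmax hS ↦ ?_⟩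
  obtain ⟨O, N, M, a, mo, τ₀, Ψ, ρ, R, U₀, Ψ₀, hera, hrs⟩ := hP 𝒟 hmax hS
  exact ⟨⟨O, N, M, a, mo, τ₀, Ψ, ρ, R, U₀, Ψ₀, hera⟩,
    hβ k X D hD 𝒟 hmax ⟨O, N, M, a, mo, τ₀, Ψ, ρ, R, U₀, Ψ₀, hera, hrs⟩⟩

/-- … with the registered stubs plugged in. -/
theorem GenericTameNonExtremalEra_of_stubs : Sig.GenericTameNonExtremalEra :=
  GenericTameNonExtremalEra_of stub_genericTameEraRedShift stub_redShiftExcludesExtremalRecurrence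

end Summit.FinalStateConjecture.FinalStateConjecture.Cruxes.GenericTameNonExtremalEra.Birth

end
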